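import Summits.BirchSwinnertonDyer.BirchSwinnertonDyer.Theorems.GoldfeldAllTwistsTwoConverseTwinGenusDescent
import Summits.BirchSwinnertonDyer.BirchSwinnertonDyer.Theorems.GoldfeldAllTwistsTwoConverseTwinGenusOddMultiple
import Summits.BirchSwinnertonDyer.BirchSwinnertonDyer.Theorems.GoldfeldK12AdditiveTwoInertSevenGenus
import Literature.NumberTheory.EllipticCurves.CyclotomicIwasawaMainTheoremIrreducibleBaseChangeProofs
import Literature.NumberTheory.EllipticCurves.MordellWeilRankZeroProofs
import Literature.NumberTheory.EllipticCurves.QuadraticTwistRank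
import HarnessLib

set_option linter.dupNamespace false
set_option autoImplicit false

/-!
# LINE B49, genus assembly (A), step W-A2 part I: over an imaginary quadratic `K` with `d_K = −4q`, every
# `K`-point of the `784`-curve `49a1^{(−1)}` is, up to torsion and one factor `2`, an ODD-index multiple
# of the fixed point `(0, 1)` — from CLTZ 2015 Thm 1.2 (`rank 49a1^{(q)}(ℚ) = 0`) and seat c301's
# odd-index theorem over `ℚ`

Cell `bsd-goldfeld`, seat `bsd-goldfeld-s1p-c3` (prover, gen 7); memo `HOME/GENUS-THEOREM-A.md` §2 (RO),
planner g16 ruling (xxxvi) (W-A2). Support for item `stmt-BirchSwinnertonDyer-19140` (crux twin″; joint with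
20044 K12₂″). Clean cone (no Theses import). HONEST FRAMING: BSD is not proved by any of this; the one printed
input is Coates–Li–Tian–Zhai 2015 Thm 1.2 (`CoatesLiTianZhai2015.thm12_fullBSD_twist`, binder `h12`).

CONTENTS.
* §1 `isOfFinAddOrder_point_cm7_quadraticTwist_prime`: for a prime `q ≡ 1 (mod 4)` inert in `ℚ(√−7)`, EVERY
  `ℚ`-point of `cm7^{(q)} = 49a1^{(q)}` (the tree's twist model) is torsion — CLTZ Thm 1.2 (`rank = 0` on a
  globally minimal model, which exists: `exists_isGloballyMinimal_smul_eq_quadraticTwist`) + Mordell–Weil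
  (`mordellWeilRank_eq_zero_iff_finite`) + transport along the change of variables; and the model identity
  `(cm7^{(−1)})^{(−4q)} = ⟨1/2, 0, 0, 0⟩ • cm7^{(q)}` (`quadraticTwist_neg_one_quadraticTwist_eq_smul`), so the
  same holds for `(49a1^{(−1)})^{(d_K)}`, `d_K = −4q` (`isOfFinAddOrder_point_twist784_discr`).
* §2 `exists_odd_two_mul_zsmul_sub_incl_zeroOne` — THE `K/ℚ` STEP of (RO): for `K` imaginary quadratic with
  `d_K = −4q` and every `P ∈ V(K)`, `V = (cm7^{(−1)})^{(1)} (= cm7^{(−1)}`, the completed-square copy used by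
  the tree's `QuadraticDescent`): there are an ODD `n` and `a ∈ ℤ` with `(2n) • P − a • (0, 1)` torsion.
  Proof: with `σ` the conjugation of `K/ℚ` (`Quadratic.conj`, `σ√d_K = −√d_K`), `2P = (P + σP) + (P − σP)`;
  `P + σP` comes from `V(ℚ)` (`exists_incl_eq`), where seat c301's
  `exists_odd_zsmul_sub_zsmul_zeroOne_cm7_quadraticTwist_neg_one` gives `n • (P + σP) ≡ a • (0,1)` with `n` odd;
  `P − σP` comes from the twist `V^{(d_K)}(ℚ)` (`exists_twistMap_eq`), all of whose points are torsion (§1).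

References: J. Coates, Y. Li, Y. Tian, S. Zhai, PLMS 110 (2015) Thm 1.2 [CoatesLiTianZhai2015]; J. H.
Silverman, AEC (2009) X.2 Prop 2.4, Ex. 10.16, VIII.6.7 [SilvermanAEC2009]; J. H. Silverman, J. T. Tate
(2015) §3.5 [SilvermanTate2015].
-/

noncomputable section

open scoped Classical

open WeierstrassCurve Literature.NumberTheory.EllipticCurves
  Literature.NumberTheory.EllipticCurves.ModularForms

namespace Summit.BirchSwinnertonDyer.BirchSwinnertonDyer.Theorems.GoldfeldGoodTwists

-- One decidability world for all point groups (ℚ, K, the genus field, K[1]): the classical one, as in the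
-- generic tree lemmas (`QuadraticDescent`, heights) and in `…TwinGenusOddMultipleTrace`.
attribute [local instance 2000] Classical.propDecidable

/-! ## §1 Every `ℚ`-point of `49a1^{(q)}` is torsion (CLTZ Thm 1.2) -/

section RankZero

/-- For a prime `q ≡ 1 (mod 4)`: `(−7/q) = (q/7)` (quadratic reciprocity, `(−1/q) = 1`), so "`q` inert in
`ℚ(√−7)`" is "`(q/7) = −1`", the family condition of LINE B49. [folklore] -/
theorem jacobiSym_neg_seven_eq {q : ℕ} (hq : q.Prime) (hq4 : q % 4 = 1) :
    jacobiSym (-7) q = jacobiSym q 7 := by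
  haveI := Fact.mk hq
  have hodd : Odd q := hq.odd_of_ne_two (by rintro rfl; norm_num at hq4)
  rw [show (-7 : ℤ) = -1 * 7 by norm_num, jacobiSym.mul_left, jacobiSym.at_neg_one hodd,
    ZMod.χ₄_nat_one_mod_four hq4, one_mul]
  exact_mod_cast jacobiSym.quadratic_reciprocity_one_mod_four' (by norm_num : Odd 7) hq4

/-- **Every `ℚ`-point of `49a1^{(q)} = cm7^{(q)}` is torsion**, for a prime `q ≡ 1 (mod 4)` with
`(q/7) = −1`: on a globally minimal model (`exists_isGloballyMinimal_smul_eq_quadraticTwist`) the rank is `0` by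
Coates–Li–Tian–Zhai 2015 Thm 1.2 (`h12`), so the Mordell–Weil group is finite
(`mordellWeilRank_eq_zero_iff_finite`); transport along the change of variables.
[cite: CoatesLiTianZhai2015, Thm. 1.2 (p. 359)] [cite: SilvermanAEC2009, Thm. VIII.6.7] -/
theorem isOfFinAddOrder_point_cm7_quadraticTwist_prime (h12 : CoatesLiTianZhai2015.thm12_fullBSD_twist)
    {q : ℕ} (hq : q.Prime) (hq4 : q % 4 = 1) (hq7 : jacobiSym q 7 = -1)
    (P : (cm7.quadraticTwist (q : ℚ)).toAffine.Point) : IsOfFinAddOrder P := by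
  have hq0 : ((q : ℚ)) ≠ 0 := by exact_mod_cast hq.ne_zero
  obtain ⟨W', hE, hM, C, hC⟩ := exists_isGloballyMinimal_smul_eq_quadraticTwist cm7 hq0
  haveI := hE; haveI := hM
  have h0 : W'.mordellWeilRank = 0 :=
    (h12 q (inertProduct_prime hq hq4 ((jacobiSym_neg_seven_eq hq hq4).trans hq7)) W' ⟨C, hC⟩).2.1
  haveI : Finite W'.toAffine.Point := W'.mordellWeilRank_eq_zero_iff_finite.mp h0
  let e : W'.toAffine.Point ≃+ (cm7.quadraticTwist (q : ℚ)).toAffine.Point :=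
    (VariableChange.pointEquiv W' C).trans (Affine.Point.congrEquiv hC)
  obtain ⟨P', rfl⟩ := e.surjective P
  exact e.toAddMonoidHom.isOfFinAddOrder (isOfFinAddOrder_of_finite P')

/-- The model identity `(cm7^{(−1)})^{(−4q)} = ⟨1/2, 0, 0, 0⟩ • cm7^{(q)}` (both are `ℚ`-models of
`49a1^{(q)}`; `b`-invariants of `cm7^{(−1)}` are `−b₂, b₄, −b₆`). [cite: SilvermanAEC2009, X.2 Prop. 2.4] -/
theorem quadraticTwist_neg_one_quadraticTwist_eq_smul (q : ℚ) :
    (cm7.quadraticTwist (-1)).quadraticTwist (-(4 * q)) =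
      (⟨Units.mk0 (2 : ℚ)⁻¹ (by norm_num), 0, 0, 0⟩ : VariableChange ℚ) • cm7.quadraticTwist q := by
  ext <;> simp [quadraticTwist, b₂, b₄, b₆, variableChange_a₁, variableChange_a₂, variableChange_a₃,
    variableChange_a₄, variableChange_a₆] <;> ring

/-- **Every `ℚ`-point of `(49a1^{(−1)})^{(−4q)}` is torsion** (same curve as `49a1^{(q)}`).
[cite: CoatesLiTianZhai2015, Thm. 1.2 (p. 359)] -/
theorem isOfFinAddOrder_point_twist784 (h12 : CoatesLiTianZhai2015.thm12_fullBSD_twist)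
    {q : ℕ} (hq : q.Prime) (hq4 : q % 4 = 1) (hq7 : jacobiSym q 7 = -1)
    (P : ((cm7.quadraticTwist (-1)).quadraticTwist (-(4 * (q : ℚ)))).toAffine.Point) : IsOfFinAddOrder P := by
  let e : ((cm7.quadraticTwist (-1)).quadraticTwist (-(4 * (q : ℚ)))).toAffine.Point ≃+
      (cm7.quadraticTwist (q : ℚ)).toAffine.Point :=
    (Affine.Point.congrEquiv (quadraticTwist_neg_one_quadraticTwist_eq_smul (q : ℚ))).trans
      (VariableChange.pointEquiv (cm7.quadraticTwist (q : ℚ)) _).symm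
  have h := isOfFinAddOrder_point_cm7_quadraticTwist_prime h12 hq hq4 hq7 (e P)
  have := e.symm.toAddMonoidHom.isOfFinAddOrder h
  simpa using this

end RankZero

/-! ## §2 The `K/ℚ` step: `K`-points of `49a1^{(−1)}` against `(0, 1)` -/

section RatStep

/-- Torsion elements are closed under sums (the torsion subgroup). [folklore] -/
theorem isOfFinAddOrder_add' {A : Type*} [AddCommGroup A] {x y : A} (hx : IsOfFinAddOrder x)
    (hy : IsOfFinAddOrder y) : IsOfFinAddOrder (x + y) := by
  rw [← AddCommGroup.mem_torsion] at hx hy ⊢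
  exact AddSubgroup.add_mem _ hx hy

/-- The completed-square copy of `cm7^{(−1)}` is `cm7^{(−1)}` itself (`a₁ = a₃ = 0` already).
[cite: SilvermanAEC2009, III.1] -/
theorem quadraticTwist_neg_one_quadraticTwist_one :
    (cm7.quadraticTwist (-1)).quadraticTwist 1 = cm7.quadraticTwist (-1) := by
  ext <;> simp [quadraticTwist, b₂, b₄, b₆]

/-- `(0, 1)` lies on the completed-square copy of `cm7^{(−1)}`. [folklore] -/
theorem nonsingular_twist784_one_zero_one :
    ((cm7.quadraticTwist (-1)).quadraticTwist 1).toAffine.Nonsingular 0 1 := by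
  rw [quadraticTwist_neg_one_quadraticTwist_one]
  exact nonsingular_cm7_quadraticTwist_neg_one_zero_one

variable {F K : Type*} [Field F] [Field K] [Algebra F K]

/-- A point of `V(K)` fixed by the conjugation of the quadratic extension `K = F(θ)` comes from `V(F)`
(the `σ`-fixed half of Silverman's Exercise 10.16; the tree proves it inside
`lift_rank_point_baseChange_quadraticTwist_one`, restated here). [cite: SilvermanAEC2009, Exercise 10.16] -/
theorem exists_incl_eq_of_conjMap_eq [NeZero (2 : F)] (V : WeierstrassCurve F) (h2 : Module.finrank F K = 2) {θ : K}
    {c : F} (hθ : θ ∉ Set.range (algebraMap F K)) (hc : θ ^ 2 = algebraMap F K c)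
    {P : (V.baseChange K).toAffine.Point}
    (hP : QuadraticDescent.conjMap V (Literature.NumberTheory.QuadraticFields.Quadratic.conj h2 hθ hc) P = P) :
    ∃ Q : V.toAffine.Point, QuadraticDescent.incl K V Q = P := by
  rcases P with _ | ⟨x, y, h⟩
  · exact ⟨0, by rw [map_zero]; rfl⟩
  · rw [Affine.Point.map_some, Affine.Point.some.injEq] at hP
    obtain ⟨a, ha⟩ :=
      Literature.NumberTheory.QuadraticFields.Quadratic.exists_eq_algebraMap_of_conj_eq h2 hθ hc hP.1
    obtain ⟨b, hb⟩ :=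
      Literature.NumberTheory.QuadraticFields.Quadratic.exists_eq_algebraMap_of_conj_eq h2 hθ hc hP.2
    exact QuadraticDescent.exists_incl_eq V h ha.symm hb.symm

/-- A point of `W^{(1)}(K)` NEGATED by the conjugation of `K = F(θ)`, `θ² = c`, comes from the twist
`W^{(c)}(F)` under the twisting map (the `σ`-anti-fixed half of Exercise 10.16, restated; needs `2 ≠ 0` in
`F`). [cite: SilvermanAEC2009, X.2 Prop. 2.4 and Exercise 10.16] -/
theorem exists_twistMap_eq_of_conjMap_eq_neg [NeZero (2 : F)] (W : WeierstrassCurve F)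
    (h2 : Module.finrank F K = 2) {θ : K} {c : F} (hθ : θ ∉ Set.range (algebraMap F K))
    (hc : θ ^ 2 = algebraMap F K c) {P : ((W.quadraticTwist 1).baseChange K).toAffine.Point}
    (hP : QuadraticDescent.conjMap (W.quadraticTwist 1)
      (Literature.NumberTheory.QuadraticFields.Quadratic.conj h2 hθ hc) P = -P) :
    ∃ R : (W.quadraticTwist c).toAffine.Point, QuadraticDescent.twistMap W hθ hc R = P := by
  rcases P with _ | ⟨x, y, h⟩
  · exact ⟨0, by rw [map_zero]; rfl⟩
  · rw [Affine.Point.map_some, Affine.Point.neg_some, Affine.Point.some.injEq,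
      QuadraticDescent.negY_quadraticTwist_one_baseChange] at hP
    obtain ⟨a, ha⟩ :=
      Literature.NumberTheory.QuadraticFields.Quadratic.exists_eq_algebraMap_of_conj_eq h2 hθ hc hP.1
    obtain ⟨b, hb⟩ :=
      Literature.NumberTheory.QuadraticFields.Quadratic.exists_eq_mul_of_conj_eq_neg h2 hθ hc hP.2
    exact QuadraticDescent.exists_twistMap_eq W hθ hc h ha.symm hb.symm

variable {K : Type} [Field K] [NumberField K]

/-- **The `K/ℚ` step of (RO).** Let `K` be imaginary quadratic with `d_K = −4q`, `q` prime with
`(q/7) = −1`, and `V = (cm7^{(−1)})^{(1)}` (`= cm7^{(−1)} = [0, 3/4, 0, −2, 1]`, a model of the `784`-curve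
`49a1^{(−1)}`). Then for EVERY `P ∈ V(K)` there are an ODD `n` and `a ∈ ℤ` with `(2n) • P − a • (0, 1)`
torsion. With `σ` the conjugation of `K/ℚ`: `2P = (P + σP) + (P − σP)`; `P + σP ∈ V(ℚ)`, where seat c301's
odd-index theorem gives `n • (P + σP) ≡ a • (0,1)` mod torsion (`n` odd); `P − σP = τ(R)` for a point `R` of
the twist `V^{(d_K)} = (49a1^{(−1)})^{(−4q)} ≅ 49a1^{(q)}` over `ℚ`, which is torsion by CLTZ 2015 Thm 1.2 (§1).
[cite: CoatesLiTianZhai2015, Thm. 1.2 (p. 359)] [cite: SilvermanAEC2009, Exercise 10.16]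
[cite: SilvermanTate2015, §3.5] -/
theorem exists_odd_two_mul_zsmul_sub_incl_zeroOne (h12 : CoatesLiTianZhai2015.thm12_fullBSD_twist)
    (hK : IsImaginaryQuadratic K) {q : ℕ} (hq : q.Prime) (hq4 : q % 4 = 1) (hq7 : jacobiSym q 7 = -1)
    (hdK : NumberField.discr K = -(4 * (q : ℤ)))
    (P : (((cm7.quadraticTwist (-1)).quadraticTwist 1).baseChange K).toAffine.Point) :
    ∃ n a : ℤ, Odd n ∧ IsOfFinAddOrder ((2 * n) • P -
      a • QuadraticDescent.incl K ((cm7.quadraticTwist (-1)).quadraticTwist 1)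
        (Affine.Point.some 0 1 nonsingular_twist784_one_zero_one)) := by
  obtain ⟨δ, hδ, hδK, -⟩ := exists_sq_eq_discr_and_span hK
  have hθ : δ ∉ Set.range (algebraMap ℚ K) := by rintro ⟨a, ha⟩; exact hδK a ha
  have hσσ : ∀ z, Literature.NumberTheory.QuadraticFields.Quadratic.conj hK.1 hθ hδ
      (Literature.NumberTheory.QuadraticFields.Quadratic.conj hK.1 hθ hδ z) = z :=
    Literature.NumberTheory.QuadraticFields.Quadratic.conj_conj hK.1 hθ hδ
  -- the `σ`-fixed part comes from `V₁(ℚ)`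
  obtain ⟨Q, hQ⟩ : ∃ Q : ((cm7.quadraticTwist (-1)).quadraticTwist 1).toAffine.Point, QuadraticDescent.incl K ((cm7.quadraticTwist (-1)).quadraticTwist 1) Q =
      P + QuadraticDescent.conjMap ((cm7.quadraticTwist (-1)).quadraticTwist 1)
        (Literature.NumberTheory.QuadraticFields.Quadratic.conj hK.1 hθ hδ) P :=
    exists_incl_eq_of_conjMap_eq ((cm7.quadraticTwist (-1)).quadraticTwist 1) hK.1 hθ hδ (by
      rw [map_add, QuadraticDescent.conjMap_conjMap ((cm7.quadraticTwist (-1)).quadraticTwist 1) hσσ, add_comm])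
  -- the `σ`-anti-fixed part comes from the twist by `d_K`, all of whose `ℚ`-points are torsion
  obtain ⟨R, hR⟩ : ∃ R : ((cm7.quadraticTwist (-1)).quadraticTwist (NumberField.discr K : ℚ)).toAffine.Point,
      QuadraticDescent.twistMap (cm7.quadraticTwist (-1)) hθ hδ R =
        P - QuadraticDescent.conjMap ((cm7.quadraticTwist (-1)).quadraticTwist 1)
          (Literature.NumberTheory.QuadraticFields.Quadratic.conj hK.1 hθ hδ) P :=
    exists_twistMap_eq_of_conjMap_eq_neg (cm7.quadraticTwist (-1)) hK.1 hθ hδ (by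
      rw [map_sub, QuadraticDescent.conjMap_conjMap ((cm7.quadraticTwist (-1)).quadraticTwist 1) hσσ, neg_sub])
  have hRt : IsOfFinAddOrder R := by
    have hc : (NumberField.discr K : ℚ) = -(4 * (q : ℚ)) := by rw [hdK]; push_cast; ring
    have e := Affine.Point.congrEquiv (congrArg (cm7.quadraticTwist (-1)).quadraticTwist hc)
    have h := isOfFinAddOrder_point_twist784 h12 hq hq4 hq7 (e R)
    simpa using e.symm.toAddMonoidHom.isOfFinAddOrder h
  -- seat c301's odd index on `V(ℚ)`, transported to the completed-square copy `V₁ = V`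
  let e₀ : (cm7.quadraticTwist (-1)).toAffine.Point ≃+ ((cm7.quadraticTwist (-1)).quadraticTwist 1).toAffine.Point :=
    Affine.Point.congrEquiv quadraticTwist_neg_one_quadraticTwist_one.symm
  obtain ⟨n, a, hn, hQa⟩ := exists_odd_zsmul_sub_zsmul_zeroOne_cm7_quadraticTwist_neg_one (e₀.symm Q)
  have hQa' : IsOfFinAddOrder (n • e₀.symm Q -
      a • Affine.Point.some 0 1 nonsingular_cm7_quadraticTwist_neg_one_zero_one) := by
    convert hQa
  have hQ1 : IsOfFinAddOrder (n • Q - a • Affine.Point.some 0 1 nonsingular_twist784_one_zero_one) := by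
    have h := e₀.toAddMonoidHom.isOfFinAddOrder hQa'
    rw [map_sub, map_zsmul, map_zsmul, AddEquiv.coe_toAddMonoidHom, AddEquiv.apply_symm_apply] at h
    have h01 : e₀ (Affine.Point.some 0 1 nonsingular_cm7_quadraticTwist_neg_one_zero_one) =
        Affine.Point.some 0 1 nonsingular_twist784_one_zero_one :=
      Affine.Point.congrEquiv_some _ _
    rwa [h01] at h
  refine ⟨n, a, hn, ?_⟩
  have e2 : (P + QuadraticDescent.conjMap ((cm7.quadraticTwist (-1)).quadraticTwist 1)
        (Literature.NumberTheory.QuadraticFields.Quadratic.conj hK.1 hθ hδ) P) +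
      (P - QuadraticDescent.conjMap ((cm7.quadraticTwist (-1)).quadraticTwist 1)
        (Literature.NumberTheory.QuadraticFields.Quadratic.conj hK.1 hθ hδ) P) = (2 : ℤ) • P := by
    abel
  have hdec : (2 * n) • P - a • QuadraticDescent.incl K ((cm7.quadraticTwist (-1)).quadraticTwist 1)
        (Affine.Point.some 0 1 nonsingular_twist784_one_zero_one) =
      QuadraticDescent.incl K ((cm7.quadraticTwist (-1)).quadraticTwist 1) (n • Q - a • Affine.Point.some 0 1 nonsingular_twist784_one_zero_one) +
        n • QuadraticDescent.twistMap (cm7.quadraticTwist (-1)) hθ hδ R := by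
    rw [mul_comm, ← smul_smul, ← e2, ← hQ, ← hR, smul_add, map_sub, map_zsmul, map_zsmul]
    abel
  rw [hdec]
  exact isOfFinAddOrder_add' ((QuadraticDescent.incl K ((cm7.quadraticTwist (-1)).quadraticTwist 1)).isOfFinAddOrder hQ1)
    (isOfFinAddOrder_zsmul n ((QuadraticDescent.twistMap _ hθ hδ).isOfFinAddOrder hRt))

end RatStep

end Summit.BirchSwinnertonDyer.BirchSwinnertonDyer.Theorems.GoldfeldGoodTwists

end
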